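import Summits.Ventures.HodgeRepro.Tier3LemmaRCorrespondenceEigen
import Summits.Ventures.HodgeRepro.Tier3WeilLineRestriction

/-!
# LEMMA R on the kernel with (S2), and its Weil line identified with `∧^{2k}_K V_B` by statement — Deligne's direct
summand on the data of `exists_weil_line_correspondence`

Blind re-derivation cell `pub-hodge-repro`, seat `t3-p4` (Tier 3, T3.5 for T3.4 = Lemma R).  Target tree path
`lean/Summits/Ventures/HodgeRepro/Tier3LemmaRCorrespondenceRestriction.lean`; imports the cell's
`Tier3LemmaRCorrespondenceEigen` and `Tier3WeilLineRestriction`.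

WHAT THIS FILE STATES (`exists_weil_line_correspondence_restrictScalars`; the companion of
`Tier3LemmaRGeneratorEigen.exists_weil_line_generator_restrictScalars` for the correspondence theorem).  The conclusion
of `exists_weil_line_correspondence_eigen` — LEMMA R's generator with the eigen-relations, the rank-one structure of
`W_F` and (S2) — together with the restriction-of-scalars map `r : ⋀[F₀]^{2k} V_B → ⋀[K]^{2k} V_B`
(`Tier3WedgeRestrictScalars.exists_restrictScalars_wedge`; named `r` here because the statement's (S2) coefficients are
`q`) and, for THAT `W_F`, the six clauses of `Tier3WeilLineRestriction.weil_line_restrictScalars` and Deligne's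
section of `exists_weil_line_section`: `r` onto, `(1 ⊗ r) E′_L = 0` off the `σ`-lines, `(1 ⊗ r) E′_{L_σ}` a
`σ`-eigenvector («`W_F(B) ⊗ ℂ = ⊕_σ ⊗_i ℓ^{(i)}_σ`»), the line images a `K`-basis of `K ⊗ ⋀[K]^{2k} V_B`, `r` injective
on `W_F`, `W_F` onto `⋀[K]^{2k} V_B`, `⋀[F₀]^{2k} V_B = W_F ⊕ ker r`, and an `F₀`-linear section `s` of `r` with
`s(⋀[K]^{2k} V_B) = W_F` — LEMMA-R-RESIDUE.md §4(b) (D1 Lemma 4.3(b)) in ONE statement with LEMMA R and (S2).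

Read with `V_red = H¹(B_red, ℚ)`, `V_B = H¹(B, ℚ)`, `K = F`, `F₀ = ℚ`, `2k = 2p`: the Weil line spanned by the pull-backs
`(m ∘ α_m)^* η` of ONE rational Hodge class `η` of `B_red` IS `∧^{2p}_F H¹(B, ℚ)` embedded by Deligne's lemma.  Nothing
mathematical moves (LEMMA-R-RESIDUE v14: residue 0 unchanged; the §18 label item closed by statement).

HONESTY.  Linear algebra on the cell's own modules; no definition is introduced; nothing geometric is built.
HC_CM is NOT proved by anyone in this repository.
-/

set_option autoImplicit false

open TensorProduct Finset

namespace HodgeRepro.Tier3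

open HodgeRepro.RouteC HodgeRepro.CMHodgeOn

section CorrespondenceRestriction

variable {F₀ K : Type*} [Field F₀] [Field K] [Algebra F₀ K]
variable {Vr VB : Type*} [AddCommGroup Vr] [Module K Vr] [Module F₀ Vr] [IsScalarTower F₀ K Vr]
  [AddCommGroup VB] [Module K VB] [Module F₀ VB] [IsScalarTower F₀ K VB]
variable {J ι : Type*} [Fintype J] [DecidableEq J] [Fintype ι] [DecidableEq ι] [DecidableEq (K ≃ₐ[F₀] K)]
variable [FiniteDimensional F₀ K] [IsGalois F₀ K] [Algebra K ℂ]

/-- **The Weil line of LEMMA R with (S2) IS `∧^{2k}_K V_B` — by statement** (Deligne LNM 900 Lemma 4.3(b) on the data of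
`exists_weil_line_correspondence`; LEMMA-R-RESIDUE.md §4(b) + v14 §18): the conclusion of
`exists_weil_line_correspondence_eigen` with the restriction-of-scalars map `r` and, for its `W_F`, the clauses of
`weil_line_restrictScalars` and `exists_weil_line_section` inserted after `dim_{F₀} W_F = [K : F₀]`; the rank-one
clauses, (S2) and LEMMA R's generator clause close the statement. -/
theorem exists_weil_line_correspondence_restrictScalars {k : ℕ} [Nonempty ι]
    (cls : ι → J) (tw : ι → K ≃ₐ[F₀] K) (hinj : Function.Injective fun i => (cls i, tw i))
    (hcard : Fintype.card ι = 2 * k)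
    (ω : Module.Basis J K Vr) (ω' : Module.Basis ι K VB) (M : Vr →ₗ[F₀] VB)
    (hM : ∀ (c : K) (j : J), M (c • ω j) = ∑ i ∈ univ.filter (fun i => cls i = j), ((tw i)⁻¹ c) • ω' i)
    [LinearOrder (J × (K ≃ₐ[F₀] K))] [LinearOrder (ι × (K ≃ₐ[F₀] K))]
    [MulAction (K ≃ₐ[F₀] K) (J × (K ≃ₐ[F₀] K))]
    (hact : ∀ (σ x : K ≃ₐ[F₀] K) (j : J), σ • (j, x) = (j, σ * x))
    [MulAction (K ≃ₐ[F₀] K) (ι × (K ≃ₐ[F₀] K))]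
    (hact' : ∀ (σ x : K ≃ₐ[F₀] K) (i : ι), σ • (i, x) = (i, σ * x))
    (i₀ : ι) :
    ∃ (e : Module.Basis (J × (K ≃ₐ[F₀] K)) K (K ⊗[F₀] Vr))
      (E : Module.Basis (Set.powersetCard (J × (K ≃ₐ[F₀] K)) (2 * k)) K (K ⊗[F₀] ⋀[F₀]^(2 * k) Vr))
      (Φ : K ⊗[F₀] ⋀[F₀]^(2 * k) Vr ≃ₗ[K] ⋀[K]^(2 * k) (K ⊗[F₀] Vr))
      (e' : Module.Basis (ι × (K ≃ₐ[F₀] K)) K (K ⊗[F₀] VB))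
      (E' : Module.Basis (Set.powersetCard (ι × (K ≃ₐ[F₀] K)) (2 * k)) K (K ⊗[F₀] ⋀[F₀]^(2 * k) VB))
      (Φ' : K ⊗[F₀] ⋀[F₀]^(2 * k) VB ≃ₗ[K] ⋀[K]^(2 * k) (K ⊗[F₀] VB))
      (WF : Submodule F₀ (⋀[F₀]^(2 * k) VB))
      (e₀ : ⋀[F₀]^(2 * k) VB →ₗ[F₀] ⋀[F₀]^(2 * k) VB)
      (r : ⋀[F₀]^(2 * k) VB →ₗ[F₀] ⋀[K]^(2 * k) VB),
      (∀ (σ x : K ≃ₐ[F₀] K) (j : J), LinearMap.rTensor Vr σ.toLinearMap (e (j, x)) = e (j, σ * x)) ∧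
      (∀ (σ x : K ≃ₐ[F₀] K) (i : ι), LinearMap.rTensor VB σ.toLinearMap (e' (i, x)) = e' (i, σ * x)) ∧
      -- the eigen-relations of `e`, `e′` under the diagonal actions `A b`, `A′ b` and under the scalars of `K`
      (∀ (x : K ≃ₐ[F₀] K) (j : J) (b : J → K),
        LinearMap.lTensor K ((ω.constr K fun j => b j • ω j).restrictScalars F₀) (e (j, x)) =
          x (b j) • e (j, x)) ∧
      (∀ (x : K ≃ₐ[F₀] K) (i : ι) (b : ι → K),
        LinearMap.lTensor K ((ω'.constr K fun i => b i • ω' i).restrictScalars F₀) (e' (i, x)) =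
          x (b i) • e' (i, x)) ∧
      (∀ (x : K ≃ₐ[F₀] K) (i : ι) (b : K),
        LinearMap.lTensor K ((LinearMap.lsmul K VB b).restrictScalars F₀) (e' (i, x)) = x b • e' (i, x)) ∧
      (∀ (x : K ≃ₐ[F₀] K) (j : J),
        LinearMap.lTensor K M (e (j, x)) = ∑ i ∈ univ.filter (fun i => cls i = j), e' (i, x * tw i)) ∧
      (∀ (c : K) (v : Fin (2 * k) → Vr),
        Φ (c ⊗ₜ[F₀] exteriorPower.ιMulti F₀ (2 * k) v) =
          c • exteriorPower.ιMulti K (2 * k) (fun i => (1 : K) ⊗ₜ[F₀] v i)) ∧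
      (∀ (c : K) (w : Fin (2 * k) → VB),
        Φ' (c ⊗ₜ[F₀] exteriorPower.ιMulti F₀ (2 * k) w) =
          c • exteriorPower.ιMulti K (2 * k) (fun i => (1 : K) ⊗ₜ[F₀] w i)) ∧
      (∀ s, Φ (E s) = exteriorPower.ιMulti_family K (2 * k) e s) ∧
      (∀ s, Φ' (E' s) = exteriorPower.ιMulti_family K (2 * k) e' s) ∧
      -- the Weil line and its rational projector
      WF.baseChange K =
        Submodule.span K (E' '' {L | ∃ σ : K ≃ₐ[F₀] K, (L : Finset (ι × (K ≃ₐ[F₀] K))) = lineSet σ}) ∧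
      (∀ v, e₀ v ∈ WF) ∧ (∀ w ∈ WF, e₀ w = w) ∧
      (∀ (v : ⋀[F₀]^(2 * k) VB) (L : Set.powersetCard (ι × (K ≃ₐ[F₀] K)) (2 * k)),
        E'.repr ((1 : K) ⊗ₜ[F₀] e₀ v) L =
          if ∃ σ : K ≃ₐ[F₀] K, (L : Finset (ι × (K ≃ₐ[F₀] K))) = lineSet σ
          then E'.repr ((1 : K) ⊗ₜ[F₀] v) L else 0) ∧
      Module.finrank F₀ WF = Module.finrank F₀ K ∧
      -- Deligne's direct summand: the Weil line IS `⋀[K]^(2k) VB` through the restriction-of-scalars map `r`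
      (∀ w : Fin (2 * k) → VB, r (exteriorPower.ιMulti F₀ (2 * k) w) = exteriorPower.ιMulti K (2 * k) w) ∧
      Function.Surjective r ∧
      (∀ L : Set.powersetCard (ι × (K ≃ₐ[F₀] K)) (2 * k),
        (¬ ∃ σ : K ≃ₐ[F₀] K, (L : Finset (ι × (K ≃ₐ[F₀] K))) = lineSet σ) → r.baseChange K (E' L) = 0) ∧
      (∀ (L : Set.powersetCard (ι × (K ≃ₐ[F₀] K)) (2 * k)) (σ : K ≃ₐ[F₀] K),
        (L : Finset (ι × (K ≃ₐ[F₀] K))) = lineSet σ → ∀ b : K,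
        LinearMap.lTensor K ((LinearMap.lsmul K (⋀[K]^(2 * k) VB) b).restrictScalars F₀) (r.baseChange K (E' L)) =
          σ b • r.baseChange K (E' L)) ∧
      (∀ U : (K ≃ₐ[F₀] K) → Set.powersetCard (ι × (K ≃ₐ[F₀] K)) (2 * k),
        (∀ σ, (U σ : Finset (ι × (K ≃ₐ[F₀] K))) = lineSet σ) →
        LinearIndependent K (fun σ => r.baseChange K (E' (U σ))) ∧
        Submodule.span K (Set.range fun σ => r.baseChange K (E' (U σ))) = ⊤) ∧
      (∀ v ∈ WF, r v = 0 → v = 0) ∧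
      (∀ y : ⋀[K]^(2 * k) VB, ∃ v ∈ WF, r v = y) ∧
      IsCompl WF (LinearMap.ker r) ∧
      (∃ s : ⋀[K]^(2 * k) VB →ₗ[F₀] ⋀[F₀]^(2 * k) VB,
        (∀ y, r (s y) = y) ∧ (∀ y, s y ∈ WF) ∧ (∀ w ∈ WF, s (r w) = w)) ∧
      -- the Weil line is a rank-one `K`-module under the first corner's action: `act(a)`-stable, every non-zero
      -- vector generates (`Tier3LemmaR.WeilRankOne` in abstract form)
      (∀ (a : K) (w : ⋀[F₀]^(2 * k) VB), w ∈ WF → exteriorPower.map (2 * k)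
        ((ω'.constr K fun i => Function.update (fun _ => (1 : K)) i₀ a i • ω' i).restrictScalars F₀) w ∈ WF) ∧
      (∀ w ∈ WF, w ≠ 0 → ∀ x ∈ WF, ∃ a : K, x = exteriorPower.map (2 * k)
        ((ω'.constr K fun i => Function.update (fun _ => (1 : K)) i₀ a i • ω' i).restrictScalars F₀) w) ∧
      -- (S2): the rational projector is an `F₀`-combination of the diagonal operators `⋀^{2k}(A′ b)`
      (∃ (N : ℕ) (q : Fin N → F₀) (b : Fin N → (ι → K)),
        e₀ = ∑ m, q m • exteriorPower.map (2 * k) ((ω'.constr K fun i => b m i • ω' i).restrictScalars F₀) ∧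
        -- LEMMA R: the generator `e · m^* η` of the Weil line, and `W_F` in the `ℚ`-span of the pull-backs of `η`
        ∀ (W : Submodule F₀ (⋀[F₀]^(2 * k) Vr)),
          (∀ s : Set.powersetCard (J × (K ≃ₐ[F₀] K)) (2 * k),
            (∃ σ, (s : Finset (J × (K ≃ₐ[F₀] K))) = reducedSet cls tw σ) → E s ∈ W.baseChange K) →
          ∃ η ∈ W, η ≠ 0 ∧
            e₀ (exteriorPower.map (2 * k) M η) ∈ WF ∧ e₀ (exteriorPower.map (2 * k) M η) ≠ 0 ∧
            ∀ x ∈ WF, ∃ a : K,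
              x = exteriorPower.map (2 * k)
                ((ω'.constr K fun i => Function.update (fun _ => (1 : K)) i₀ a i • ω' i).restrictScalars F₀)
                (e₀ (exteriorPower.map (2 * k) M η)) ∧
              x = ∑ m, q m • exteriorPower.map (2 * k)
                ((ω'.constr K fun i => (Function.update (fun _ => (1 : K)) i₀ a * b m) i • ω' i).restrictScalars F₀)
                (exteriorPower.map (2 * k) M η)) := by
  classical
  obtain ⟨e, E, Φ, e', E', Φ', WF, e₀, he1, he1', he2, he2', hscal, hMe, hΦ, hΦ', hE, hE', hWF, he₀mem, he₀id,
      hrepr, hdim, hstable, hrank, hS2⟩ :=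
    exists_weil_line_correspondence_eigen cls tw hinj hcard ω ω' M hM hact hact' i₀
  have hn0 : 0 < 2 * k := hcard ▸ Fintype.card_pos
  -- `E′` in the form `Tier3WeilLineRestriction` uses
  have hE'symm : ∀ L, E' L = Φ'.symm (exteriorPower.ιMulti_family K (2 * k) e' L) := fun L => by
    rw [← hE' L, LinearEquiv.symm_apply_apply]
  -- the restriction-of-scalars map and Deligne's direct summand for THIS `W_F`
  obtain ⟨r, hr⟩ := exists_restrictScalars_wedge (F₀ := F₀) (K := K) (V := VB) (2 * k)
  obtain ⟨h1, h2, h3, h4, h5, h6⟩ :=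
    weil_line_restrictScalars ω' hcard e' hscal Φ' hΦ' E' hE'symm WF hWF r hr
  obtain ⟨s, hs⟩ := exists_weil_line_section ω' hcard e' hscal Φ' hΦ' E' hE'symm WF hWF r hr
  exact ⟨e, E, Φ, e', E', Φ', WF, e₀, r, he1, he1', he2, he2', hscal, hMe, hΦ, hΦ', hE, hE', hWF, he₀mem, he₀id,
    hrepr, hdim, hr, surjective_of_ιMulti_eq hn0 r hr, h1, h2, h3, h4, h5, h6, ⟨s, hs⟩, hstable, hrank, hS2⟩

end CorrespondenceRestriction

end HodgeRepro.Tier3
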